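import Mathlib
import Summits.PneNP.PneNP.Theorems.OverlapGapAlgebraSearchHardWindowThresholdTails
import Summits.PneNP.PneNP.Theorems.OverlapGapAlgebraSearchHardWindowThresholdRung
import Summits.PneNP.PneNP.Theorems.OverlapGapAlgebraSearchHardWindowSlotRobustClassRung

/-!
# Route OverlapGapAlgebra, crux `SearchHardWindow` (stmt-PneNP-2460): the DEPTH-TWO THRESHOLD
# CIRCUIT rung — Boolean functions of `o(√n / log n)` threshold statistics per output bit fail

Strengthening of the threshold-statistic rung (`thresholdStatisticRung`, one statistic, top gate
the identity) to depth two: each output bit is an ARBITRARY Boolean function `H_v` of `s` threshold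
statistics `[θ_{v,t} < Σ_{slots} w_{v,t}(Φ_slot)]`, `t < s`, with arbitrary real weights — i.e. a
depth-two circuit whose bottom level consists of `s` unbounded-weight threshold gates over the
one-hot instance code and whose top gate is unrestricted (intersections/unions of `s` halfspaces,
decision lists and decision trees over `s` votes, small two-layer perceptrons, …), one circuit per
output variable, `s ≤ S(n)` with `S(n)² = o(n / log² n)`, e.g. `S(n) = √n / log² n`.

* `shwT_card_resample_ne_le_sum` — union bound: resampling a block changes `H(f_1,…,f_s)` only if
  it changes some `f_t`.
* `shwT_tail_le_of_resample_le` — the tail theorem of `…ThresholdTails.lean` abstracted from Peres: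
  if for every block labelling `P : ι → Fin d` the summed resampling counts of `g` are
  `≤ B · #points²`, then `Σ_{|S| ≥ d} ‖G^{=S}‖² ≤ (4B/d) · #points`.
* `shwT_tail_le_multi` — hence `Σ_{|S| ≥ d} ‖G^{=S}‖² ≤ (4s/√d) · #points` for a Boolean function of
  `s` additive-threshold statistics (Peres's `B = √d` per statistic, `shwT_symm`).
* `thresholdCircuitRung` — the rung, from `slotRobustClassRung` at the level
  `D_τ(n) = ⌈(4 (S(n)+1)/τ)²⌉ + 1 = o(n / log² n)`.

No new definitions; axioms standard. References: Y. Peres, arXiv:math/0412377 [Peres2004];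
R. O'Donnell 2014, §5.5 (noise sensitivity of functions of `s` LTFs: union bound) [ODonnell2014].
-/

set_option linter.dupNamespace false -- `Summit.PneNP.PneNP.…`: summit = sub-problem (D-0017)

noncomputable section

namespace Summit.PneNP.PneNP.Theorems

open Finset Filter Asymptotics
open Literature.Computability.Complexity
open Literature.Probability.Moments
open scoped Classical

/-- **Union bound for resampling counts.** If `g = H ∘ (f_t)_t`, the pairs on which resampling
the block `T` changes `g` are among those on which it changes some `f_t`. [folklore] -/
theorem shwT_card_resample_ne_le_sum {ι Γ : Type*} [Fintype ι] [DecidableEq ι] [Fintype Γ]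
    {s : ℕ} (f : Fin s → (ι → Γ) → Bool) (H : (Fin s → Bool) → Bool) (g : (ι → Γ) → Bool)
    (hg : ∀ y, g y = H (fun t => f t y)) (T : Finset ι) :
    ((univ.filter fun p : (ι → Γ) × (ι → Γ) => g p.1 ≠ g (T.piecewise p.2 p.1)).card : ℝ) ≤
      ∑ t : Fin s, ((univ.filter fun p : (ι → Γ) × (ι → Γ) =>
        f t p.1 ≠ f t (T.piecewise p.2 p.1)).card : ℝ) := by
  have hsub : (univ.filter fun p : (ι → Γ) × (ι → Γ) => g p.1 ≠ g (T.piecewise p.2 p.1)) ⊆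
      (univ : Finset (Fin s)).biUnion (fun t => univ.filter fun p : (ι → Γ) × (ι → Γ) =>
        f t p.1 ≠ f t (T.piecewise p.2 p.1)) := by
    intro p hp
    rw [mem_filter] at hp
    rw [mem_biUnion]
    by_contra hall
    push Not at hall
    apply hp.2
    rw [hg, hg]
    congr 1
    funext t
    by_contra hne
    exact hall t (mem_univ t) (mem_filter.2 ⟨mem_univ _, hne⟩)
  calc ((univ.filter fun p : (ι → Γ) × (ι → Γ) => g p.1 ≠ g (T.piecewise p.2 p.1)).card : ℝ)
      ≤ ((univ : Finset (Fin s)).biUnion (fun t => univ.filter fun p : (ι → Γ) × (ι → Γ) =>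
          f t p.1 ≠ f t (T.piecewise p.2 p.1))).card := by exact_mod_cast card_le_card hsub
    _ ≤ _ := by exact_mod_cast card_biUnion_le

/-- **Tails from summed resampling counts** (the argument of `shwT_tail_le`, abstracted from
Peres's theorem): if for every block labelling `P : ι → Fin d` (`d ≥ 1`) the number of pairs
`(y, z)` on which resampling block `j` of `y` from `z` changes `g`, summed over `j`, is at most
`B · #(ι → Γ)²`, then `Σ_{|S| ≥ d} ‖G^{=S}‖² ≤ (4B/d) · #(ι → Γ)` for `G = (±1)^g`.
[cite: ODonnell2014, §3.1 Prop. 3.3] -/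
theorem shwT_tail_le_of_resample_le {ι Γ : Type*} [Fintype ι] [DecidableEq ι] [Fintype Γ]
    [Nonempty Γ] (g : (ι → Γ) → Bool) (d : ℕ) (hd : 1 ≤ d) (B : ℝ)
    (hB : ∀ P : ι → Fin d, ∑ j : Fin d, ((univ.filter fun p : (ι → Γ) × (ι → Γ) =>
        g p.1 ≠ g ((univ.filter fun i => P i = j).piecewise p.2 p.1)).card : ℝ)
      ≤ B * (Fintype.card (ι → Γ) : ℝ) ^ 2) :
    ∑ S ∈ (univ : Finset ι).powerset.filter (fun S => d ≤ S.card),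
        ∑ y, hoeffdingComp S (fun y => if g y then (1 : ℝ) else -1) y ^ 2
      ≤ 4 * B / d * Fintype.card (ι → Γ) := by
  haveI : NeZero d := ⟨by omega⟩
  have hNf : (0 : ℝ) < Fintype.card (ι → Γ) := by exact_mod_cast Fintype.card_pos
  have hNP : (0 : ℝ) < Fintype.card (ι → Fin d) := by exact_mod_cast Fintype.card_pos
  have hdpos : (0 : ℝ) < d := by exact_mod_cast hd
  have hb0 : ∀ S : Finset ι,
      0 ≤ ∑ y, hoeffdingComp S (fun y => if g y then (1 : ℝ) else -1) y ^ 2 :=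
    fun S => sum_nonneg fun y _ => sq_nonneg _
  -- (1) the moving part at one block is a resampling count
  have h1 : ∀ (P : ι → Fin d) (j : Fin d),
      (Fintype.card (ι → Γ) : ℝ) *
        ∑ S ∈ (univ : Finset ι).powerset.filter
          (fun S => ¬ Disjoint S (univ.filter fun i => P i = j)),
          ∑ y, hoeffdingComp S (fun y => if g y then (1 : ℝ) else -1) y ^ 2 =
      2 * ((univ.filter fun p : (ι → Γ) × (ι → Γ) =>
        g p.1 ≠ g ((univ.filter fun i => P i = j).piecewise p.2 p.1)).card : ℝ) := by
    intro P j
    have h := card_resample_ne_eq (univ.filter fun i => P i = j) g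
    linarith
  -- (2) summed over blocks and labellings: the hypothesis
  have h2 : ∑ P : ι → Fin d, ∑ j : Fin d, (Fintype.card (ι → Γ) : ℝ) *
        ∑ S ∈ (univ : Finset ι).powerset.filter
          (fun S => ¬ Disjoint S (univ.filter fun i => P i = j)),
          ∑ y, hoeffdingComp S (fun y => if g y then (1 : ℝ) else -1) y ^ 2 ≤
      Fintype.card (ι → Fin d) * (2 * (B * (Fintype.card (ι → Γ) : ℝ) ^ 2)) := by
    calc ∑ P : ι → Fin d, ∑ j : Fin d, (Fintype.card (ι → Γ) : ℝ) *
          ∑ S ∈ (univ : Finset ι).powerset.filter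
            (fun S => ¬ Disjoint S (univ.filter fun i => P i = j)),
            ∑ y, hoeffdingComp S (fun y => if g y then (1 : ℝ) else -1) y ^ 2
        = ∑ P : ι → Fin d, 2 * ∑ j : Fin d, ((univ.filter fun p : (ι → Γ) × (ι → Γ) =>
            g p.1 ≠ g ((univ.filter fun i => P i = j).piecewise p.2 p.1)).card : ℝ) := by
          refine sum_congr rfl fun P _ => ?_
          rw [mul_sum]
          exact sum_congr rfl fun j _ => h1 P j
      _ ≤ ∑ _P : ι → Fin d, 2 * (B * (Fintype.card (ι → Γ) : ℝ) ^ 2) := by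
          refine sum_le_sum fun P _ => ?_
          linarith [hB P]
      _ = Fintype.card (ι → Fin d) * (2 * (B * (Fintype.card (ι → Γ) : ℝ) ^ 2)) := by
          rw [sum_const, card_univ, nsmul_eq_mul]
  -- (3) exchange the sums
  have h3 : ∑ P : ι → Fin d, ∑ j : Fin d, (Fintype.card (ι → Γ) : ℝ) *
        ∑ S ∈ (univ : Finset ι).powerset.filter
          (fun S => ¬ Disjoint S (univ.filter fun i => P i = j)),
          ∑ y, hoeffdingComp S (fun y => if g y then (1 : ℝ) else -1) y ^ 2 =
      (Fintype.card (ι → Γ) : ℝ) * ∑ S ∈ (univ : Finset ι).powerset,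
        (∑ y, hoeffdingComp S (fun y => if g y then (1 : ℝ) else -1) y ^ 2) *
        ∑ P : ι → Fin d, ((univ.filter fun j : Fin d =>
          ¬ Disjoint S (univ.filter fun i => P i = j)).card : ℝ) := by
    simp only [← mul_sum]
    congr 1
    simp only [sum_filter]
    refine (sum_congr rfl fun P _ => sum_comm).trans ?_
    rw [sum_comm]
    refine sum_congr rfl fun S _ => ?_
    rw [mul_sum]
    refine sum_congr rfl fun P _ => ?_
    rw [card_eq_sum_ones, Nat.cast_sum, sum_filter, mul_sum]
    refine sum_congr rfl fun j _ => ?_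
    split_ifs <;> simp
  -- (4) keep only the sets of size `≥ d`
  have h4 : (d : ℝ) / 2 * Fintype.card (ι → Fin d) *
      ∑ S ∈ (univ : Finset ι).powerset.filter (fun S => d ≤ S.card),
        ∑ y, hoeffdingComp S (fun y => if g y then (1 : ℝ) else -1) y ^ 2 ≤
      ∑ S ∈ (univ : Finset ι).powerset,
        (∑ y, hoeffdingComp S (fun y => if g y then (1 : ℝ) else -1) y ^ 2) *
        ∑ P : ι → Fin d, ((univ.filter fun j : Fin d =>
          ¬ Disjoint S (univ.filter fun i => P i = j)).card : ℝ) := by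
    rw [mul_sum]
    calc ∑ S ∈ (univ : Finset ι).powerset.filter (fun S => d ≤ S.card),
          (d : ℝ) / 2 * Fintype.card (ι → Fin d) *
            ∑ y, hoeffdingComp S (fun y => if g y then (1 : ℝ) else -1) y ^ 2
        ≤ ∑ S ∈ (univ : Finset ι).powerset.filter (fun S => d ≤ S.card),
          (∑ y, hoeffdingComp S (fun y => if g y then (1 : ℝ) else -1) y ^ 2) *
            ∑ P : ι → Fin d, ((univ.filter fun j : Fin d =>
              ¬ Disjoint S (univ.filter fun i => P i = j)).card : ℝ) := by
          refine sum_le_sum fun S hS => ?_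
          rw [mul_comm]
          exact mul_le_mul_of_nonneg_left (shwT_bins d hd S (mem_filter.1 hS).2) (hb0 S)
      _ ≤ _ := by
          refine sum_le_sum_of_subset_of_nonneg (filter_subset _ _) fun S _ _ => ?_
          exact mul_nonneg (hb0 S) (sum_nonneg fun P _ => Nat.cast_nonneg _)
  -- (5) combine and divide
  have hM : (0 : ℝ) < Fintype.card (ι → Γ) * ((d : ℝ) / 2 * Fintype.card (ι → Fin d)) := by
    positivity
  have key : Fintype.card (ι → Γ) * ((d : ℝ) / 2 * Fintype.card (ι → Fin d)) *
      ∑ S ∈ (univ : Finset ι).powerset.filter (fun S => d ≤ S.card),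
        ∑ y, hoeffdingComp S (fun y => if g y then (1 : ℝ) else -1) y ^ 2 ≤
      Fintype.card (ι → Fin d) * (2 * (B * (Fintype.card (ι → Γ) : ℝ) ^ 2)) := by
    rw [mul_assoc]
    refine le_trans (mul_le_mul_of_nonneg_left h4 hNf.le) ?_
    rw [← h3]
    exact h2
  have heq : (Fintype.card (ι → Fin d) : ℝ) * (2 * (B * (Fintype.card (ι → Γ) : ℝ) ^ 2)) =
      Fintype.card (ι → Γ) * ((d : ℝ) / 2 * Fintype.card (ι → Fin d)) *
        (4 * B / d * Fintype.card (ι → Γ)) := by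
    field_simp
    ring
  rw [heq] at key
  exact le_of_mul_le_mul_left key hM

/-- **Tails of a Boolean function of `s` threshold statistics.** For `g = H(f_0, …, f_{s-1})` with
`f_t y = [θ t < Σ_i w t i (y i)]` and `d ≥ 1`: `Σ_{|S| ≥ d} ‖G^{=S}‖² ≤ (4 s/√d) · #(ι → Γ)`
(union bound over the statistics, then Peres per statistic via `shwT_symm`).
[cite: Peres2004, Thm. 1] -/
theorem shwT_tail_le_multi {ι Γ : Type*} [Fintype ι] [DecidableEq ι] [Fintype Γ] [Nonempty Γ]
    {s : ℕ} (f : Fin s → (ι → Γ) → Bool) (w : Fin s → ι → Γ → ℝ) (θ : Fin s → ℝ)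
    (hf : ∀ t y, f t y = decide (θ t < ∑ i, w t i (y i))) (H : (Fin s → Bool) → Bool)
    (g : (ι → Γ) → Bool) (hg : ∀ y, g y = H (fun t => f t y)) (d : ℕ) (hd : 1 ≤ d) :
    ∑ S ∈ (univ : Finset ι).powerset.filter (fun S => d ≤ S.card),
        ∑ y, hoeffdingComp S (fun y => if g y then (1 : ℝ) else -1) y ^ 2
      ≤ 4 * s / Real.sqrt d * Fintype.card (ι → Γ) := by
  have hdpos : (0 : ℝ) < d := by exact_mod_cast hd
  have hB : ∀ P : ι → Fin d, ∑ j : Fin d, ((univ.filter fun p : (ι → Γ) × (ι → Γ) =>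
      g p.1 ≠ g ((univ.filter fun i => P i = j).piecewise p.2 p.1)).card : ℝ)
      ≤ s * Real.sqrt d * (Fintype.card (ι → Γ) : ℝ) ^ 2 := by
    intro P
    calc ∑ j : Fin d, ((univ.filter fun p : (ι → Γ) × (ι → Γ) =>
          g p.1 ≠ g ((univ.filter fun i => P i = j).piecewise p.2 p.1)).card : ℝ)
        ≤ ∑ j : Fin d, ∑ t : Fin s, ((univ.filter fun p : (ι → Γ) × (ι → Γ) =>
          f t p.1 ≠ f t ((univ.filter fun i => P i = j).piecewise p.2 p.1)).card : ℝ) :=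
          sum_le_sum fun j _ => shwT_card_resample_ne_le_sum f H g hg _
      _ = ∑ t : Fin s, ∑ j : Fin d, ((univ.filter fun p : (ι → Γ) × (ι → Γ) =>
          f t p.1 ≠ f t ((univ.filter fun i => P i = j).piecewise p.2 p.1)).card : ℝ) := sum_comm
      _ ≤ ∑ _t : Fin s, Real.sqrt d * (Fintype.card (ι → Γ) : ℝ) ^ 2 := by
          refine sum_le_sum fun t _ => ?_
          have := shwT_symm (f t) (w t) (θ t) (hf t) P
          rwa [Fintype.card_fin] at this
      _ = s * Real.sqrt d * (Fintype.card (ι → Γ) : ℝ) ^ 2 := by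
          rw [sum_const, card_univ, Fintype.card_fin, nsmul_eq_mul]; ring
  refine (shwT_tail_le_of_resample_le g d hd _ hB).trans (le_of_eq ?_)
  congr 1
  rw [show (4 : ℝ) * (s * Real.sqrt d) / d = 4 * s * (Real.sqrt d / d) by ring, Real.sqrt_div_self']
  ring

/-- **The depth-two threshold-circuit rung (unconditional).** There is `k₀` such that for all
`k ≥ k₀` and every gate budget `S : ℕ → ℕ` with `S(n)² = o(n / log² n)`, for every `ε > 0`,
eventually in `n`, with `m = ⌊5 · 2^k log k / k · n⌋`: for every `s ≤ S(n)`, all real weights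
`w v t i j : literals → ℝ`, thresholds `θ v t` and top gates `H v : (Fin s → Bool) → Bool`, the
assignment `σ_v(Φ) = H v (t ↦ [θ v t < Σ_i Σ_j w v t i j (Φ i j)])` satisfies `Φ ∼ F_k(n, m)` for at
most `ε · #instances` instances. [cite: Peres2004, Thm. 1] -/
theorem thresholdCircuitRung :
    ∃ k₀ : ℕ, ∀ k : ℕ, k₀ ≤ k → ∀ S : ℕ → ℕ,
      (fun n : ℕ => (S n : ℝ) ^ 2) =o[atTop] (fun n : ℕ => (n : ℝ) / Real.log n ^ 2) →
      ∀ ε : ℝ, 0 < ε →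
      ∀ᶠ n : ℕ in atTop, ∀ m : ℕ, m = ⌊5 * 2 ^ k * Real.log k / k * n⌋₊ →
        ∀ (s : ℕ), s ≤ S n →
        ∀ (w : Fin n → Fin s → Fin m → Fin k → Fin n × Bool → ℝ) (θ : Fin n → Fin s → ℝ)
          (H : Fin n → (Fin s → Bool) → Bool)
          (g : Fin n → (Fin m → Fin k → Fin n × Bool) → Bool),
          (∀ v Φ, g v Φ = H v (fun t => decide (θ v t < ∑ i, ∑ j, w v t i j (Φ i j)))) →
          ((univ.filter fun Φ : Fin m → Fin k → Fin n × Bool =>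
              ∀ i : Fin m, ∃ j : Fin k, g (Φ i j).1 Φ = (Φ i j).2).card : ℝ)
            ≤ ε * Fintype.card (Fin m → Fin k → Fin n × Bool) := by
  obtain ⟨k₀, hk₀⟩ := slotRobustClassRung
  refine ⟨k₀, fun k hk S hS ε hε => ?_⟩
  -- the class: Boolean functions of `≤ S n` threshold statistics on the slot space
  set 𝒢 : (n m : ℕ) → ((Fin m × Fin k → Fin n × Bool) → Bool) → Prop := fun n m g =>
    ∃ (s : ℕ) (_ : s ≤ S n) (w : Fin s → Fin m × Fin k → Fin n × Bool → ℝ) (θ : Fin s → ℝ)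
      (H : (Fin s → Bool) → Bool),
      ∀ y, g y = H (fun t => decide (θ t < ∑ p : Fin m × Fin k, w t p (y p))) with h𝒢
  have hclass : ∀ τ : ℝ, 0 < τ → ∃ D : ℕ → ℕ,
      (fun n : ℕ => (D n : ℝ)) =o[atTop] (fun n : ℕ => (n : ℝ) / Real.log n ^ 2) ∧
      ∀ᶠ n : ℕ in atTop, ∀ (m : ℕ) (g : (Fin m × Fin k → Fin n × Bool) → Bool), 𝒢 n m g →
        ∑ y : Fin m × Fin k → Fin n × Bool, ((if g y then (1 : ℝ) else -1) -
          ∑ T ∈ (univ : Finset (Fin m × Fin k)).powerset.filter (fun T => T.card < D n),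
            hoeffdingComp T (fun y => if g y then (1 : ℝ) else -1) y) ^ 2
          ≤ τ * Fintype.card (Fin m × Fin k → Fin n × Bool) := by
    intro τ hτ
    set D : ℕ → ℕ := fun n => ⌈(4 * ((S n : ℝ) + 1) / τ) ^ 2⌉₊ + 1 with hD
    refine ⟨D, ?_, ?_⟩
    · -- `D n ≤ 2 (16/τ²) S(n)² + (2 · 16/τ² + 2) = o(n / log² n)`
      have hbound : ∀ n : ℕ, (D n : ℝ) ≤
          2 * (16 / τ ^ 2 * (S n : ℝ) ^ 2) + (2 * (16 / τ ^ 2) + 2) := by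
        intro n
        have hx0 : (0 : ℝ) ≤ (4 * ((S n : ℝ) + 1) / τ) ^ 2 := sq_nonneg _
        have hceil := (Nat.ceil_lt_add_one hx0).le
        have hD' : (D n : ℝ) = (⌈(4 * ((S n : ℝ) + 1) / τ) ^ 2⌉₊ : ℝ) + 1 := by
          simp only [hD]; push_cast; ring
        rw [hD']
        have hsq : (4 * ((S n : ℝ) + 1) / τ) ^ 2 = 16 / τ ^ 2 * ((S n : ℝ) + 1) ^ 2 := by
          field_simp
          norm_num
        have h16 : (0 : ℝ) ≤ 16 / τ ^ 2 := by positivity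
        have hkey : 16 / τ ^ 2 * ((S n : ℝ) + 1) ^ 2 ≤
            2 * (16 / τ ^ 2 * (S n : ℝ) ^ 2) + 2 * (16 / τ ^ 2) := by
          have h1 : ((S n : ℝ) + 1) ^ 2 ≤ 2 * (S n : ℝ) ^ 2 + 2 := by
            nlinarith [sq_nonneg ((S n : ℝ) - 1)]
          calc 16 / τ ^ 2 * ((S n : ℝ) + 1) ^ 2 ≤ 16 / τ ^ 2 * (2 * (S n : ℝ) ^ 2 + 2) :=
                mul_le_mul_of_nonneg_left h1 h16
            _ = 2 * (16 / τ ^ 2 * (S n : ℝ) ^ 2) + 2 * (16 / τ ^ 2) := by ring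
        linarith [hkey, hceil, hsq.le, hsq.ge]
      have ho : (fun n : ℕ => 2 * (16 / τ ^ 2 * (S n : ℝ) ^ 2) + (2 * (16 / τ ^ 2) + 2)) =o[atTop]
          (fun n : ℕ => (n : ℝ) / Real.log n ^ 2) := by
        refine ((hS.const_mul_left (16 / τ ^ 2)).const_mul_left 2).add ?_
        have h1 := (shwT_const_isLittleO 1).const_mul_left (2 * (16 / τ ^ 2) + 2)
        simpa using h1
      refine IsBigO.trans_isLittleO ?_ ho
      refine isBigO_of_le _ fun n => ?_
      rw [Real.norm_eq_abs, Real.norm_eq_abs, abs_of_nonneg (Nat.cast_nonneg _)]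
      exact (hbound n).trans (le_abs_self _)
    · filter_upwards [eventually_ge_atTop 1] with n hn1 m g hg
      haveI : Nonempty (Fin n × Bool) := ⟨(⟨0, hn1⟩, true)⟩
      obtain ⟨s, hs, w, θ, H, hgH⟩ := hg
      have hD1 : 1 ≤ D n := by simp only [hD]; omega
      have hDpos : (0 : ℝ) < D n := by exact_mod_cast hD1
      have htail := shwT_tail_le_multi (fun t y => decide (θ t < ∑ p : Fin m × Fin k, w t p (y p)))
        w θ (fun t y => rfl) H g hgH (D n) hD1
      rw [sum_sq_sub_truncation_eq]
      refine htail.trans (mul_le_mul_of_nonneg_right ?_ (Nat.cast_nonneg _))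
      -- `4 s / √(D n) ≤ τ` since `√(D n) ≥ 4 (S n + 1) / τ`
      have hsqrt : 4 * ((S n : ℝ) + 1) / τ ≤ Real.sqrt (D n) := by
        have hDR : (4 * ((S n : ℝ) + 1) / τ) ^ 2 ≤ (D n : ℝ) := by
          simp only [hD]; push_cast
          linarith [Nat.le_ceil ((4 * ((S n : ℝ) + 1) / τ) ^ 2)]
        calc 4 * ((S n : ℝ) + 1) / τ = Real.sqrt ((4 * ((S n : ℝ) + 1) / τ) ^ 2) := by
              rw [Real.sqrt_sq (by positivity)]
          _ ≤ Real.sqrt (D n) := Real.sqrt_le_sqrt hDR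
      have hsqpos : 0 < Real.sqrt (D n) := Real.sqrt_pos.2 hDpos
      rw [div_le_iff₀ hsqpos]
      rw [div_le_iff₀ hτ] at hsqrt
      have hsS : (s : ℝ) ≤ S n := by exact_mod_cast hs
      nlinarith
  have hev := hk₀ k hk 𝒢 hclass ε hε
  filter_upwards [hev] with n hn m hm s hs w θ H g hg
  refine hn m hm g fun v => ?_
  refine ⟨s, hs, fun t p ℓ => w v t p.1 p.2 ℓ, θ v, H v, fun y => ?_⟩
  show g v (Function.curry y) = _
  rw [hg]
  congr 1
  funext t
  refine decide_eq_decide.mpr ?_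
  rw [← Fintype.sum_prod_type']
  rfl

end Summit.PneNP.PneNP.Theorems

end
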